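import Mathlib.Topology.Algebra.UniformRing
import Mathlib.Topology.Algebra.Ring.Basic
import HarnessLib

/-!
# Continuous ring homomorphisms extend from a subring to its topological closure

Topic `Topology/Algebra`; namespace `Literature.Topology.Algebra`.
Theorems only; no named fact, no `sorry`.

* **`Subring.exists_continuous_extend_topologicalClosure`** — for a topological ring `B`, a
  subring `R₀ ≤ B` and a continuous ring homomorphism `f : R₀ → γ` into a COMPLETE Hausdorff
  topological ring `γ` (with its additive uniform structure), there is a continuous ring
  homomorphism `g : R₀.topologicalClosure → γ` extending `f` (Mathlib
  `IsDenseInducing.extendRingHom` for the right uniformity of `B`; a continuous additive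
  homomorphism is uniformly continuous).

Use: a Hecke eigensystem `x₀ : ℤ[T_{v,i}] → E` that is continuous for the topology induced by the
completed cohomology extends to the completed (big) Hecke algebra, the CLOSURE of the polynomial
algebra [CalegariEmerton2011, §2], [Scholze2015, Rem. V.4.5] — provided `E` is complete (a finite
extension of `ℚ_p`, not `ℚ̄_p`).

## References

* N. Bourbaki, *Topologie générale*, Ch. III §3 no. 3 (extension of uniformly continuous
  homomorphisms to the completion/closure). [folklore]
-/

noncomputable section

open Topology Filter Set

namespace Literature.Topology.Algebra

variable {B : Type*} [Ring B] [TopologicalSpace B] [IsTopologicalRing B]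
  {γ : Type*} [Ring γ] [UniformSpace γ] [IsTopologicalRing γ] [IsUniformAddGroup γ] [T2Space γ]
  [CompleteSpace γ]

/-- A subring of a uniform additive group is a uniform additive group. [folklore] -/
theorem isUniformAddGroup_subring {B' : Type*} [Ring B'] [UniformSpace B'] [IsUniformAddGroup B']
    (S : Subring B') : IsUniformAddGroup S :=
  ⟨((uniformContinuous_subtype_val.comp uniformContinuous_fst).sub
      (uniformContinuous_subtype_val.comp uniformContinuous_snd)).subtype_mk _⟩

/-- **Continuous ring homomorphisms extend to the topological closure** (complete Hausdorff
target). [folklore] -/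
theorem Subring.exists_continuous_extend_topologicalClosure (R₀ : Subring B) (f : R₀ →+* γ)
    (hf : Continuous f) :
    ∃ g : R₀.topologicalClosure →+* γ, Continuous g ∧
      ∀ x : R₀, g (Subring.inclusion R₀.le_topologicalClosure x) = f x := by
  letI : UniformSpace B := IsTopologicalAddGroup.rightUniformSpace B
  haveI : IsUniformAddGroup B := isUniformAddGroup_of_addCommGroup
  haveI : IsUniformAddGroup R₀ := isUniformAddGroup_subring R₀
  haveI : IsUniformAddGroup R₀.topologicalClosure := isUniformAddGroup_subring _
  let i : R₀ →+* R₀.topologicalClosure := Subring.inclusion R₀.le_topologicalClosure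
  have ue : IsUniformInducing i :=
    (isUniformInducing_val (R₀.topologicalClosure : Set B)).of_comp_iff.1
      (isUniformInducing_val (R₀ : Set B))
  have dr : DenseRange i := by
    rw [DenseRange, Subtype.dense_iff]
    intro b hb
    have hb' : b ∈ closure (R₀ : Set B) := hb
    refine closure_mono ?_ hb'
    intro y hy
    exact ⟨⟨y, R₀.le_topologicalClosure hy⟩, ⟨⟨y, hy⟩, rfl⟩, rfl⟩
  have hfu : UniformContinuous f := uniformContinuous_addMonoidHom_of_continuous hf
  refine ⟨IsDenseInducing.extendRingHom ue dr hfu, ?_, fun x => ?_⟩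
  · exact (uniformContinuous_uniformly_extend ue dr hfu).continuous
  · exact IsDenseInducing.extend_eq (ue.isDenseInducing dr) hfu.continuous x

end Literature.Topology.Algebra
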